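import Mathlib
import Summits.CriticalPhenomena.CardyFormulaZ2.Theorems.CardyMagicRigidityHexSegmentDefs
import Summits.CriticalPhenomena.CardyFormulaZ2.Theorems.CardyMagicRigidityLoopLimitZ2EqTSiteEndLaw
import Summits.CriticalPhenomena.CardyFormulaZ2.Theorems.CardyMagicRigidityLoopLimitZ2EqTSiteEndCrossingsCells
import Summits.CriticalPhenomena.CardyFormulaZ2.Theorems.CardyMagicRigidityLoopLimitZ2EqTSiteEndCrossingsQuad
import Summits.CriticalPhenomena.CardyFormulaZ2.Theorems.CardyIKTransportIKLinearTransportStubCrudeCardySiteTri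
import Summits.CriticalPhenomena.CardyFormulaZ2.Theorems.CardyMagicRigidityLoopsToCrossingsStubCardyContinuity
import Summits.CriticalPhenomena.CardyFormulaZ2.Theorems.CardyMagicRigidityLoopsToCrossingsStubCyclicFlip
import Literature.Probability.Percolation.CardyFormula
import Literature.Probability.Percolation.CardyFormulaConformalInvariance
import Literature.Probability.Percolation.TriPlatePolarisation
import HarnessLib

/-!
# Stub `stub_siteEndCrossings` (S7a) of line `Sketch`, crux `LoopLimitZ2EqT` (stmt-CriticalPhenomena-4833):
# Cardy's formula for the crude crossing probabilities of the all-or-nothing model `M₀`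

Helper file (`--supports stmt-CriticalPhenomena-4833`) proving the registered stub
`stub_siteEndCrossings : ∀ R, R.HasCrossingLimit (segCross 0 R) cardyFunction` — the endpoint
dictionary at `t = 0` AT CROSSING LEVEL: for every conformal rectangle `R = (Ω; a, b, c, d)`, the
probability under `prodBernoulli (prm 0)` of the crude embedded crossing event
`cfg S ∈ embDomainCrossing triEmbed Ω δ (ab) (cd)` tends to `F(η_R)` as `δ → 0⁺`.

Proof. (A) Dictionary: almost surely `cfg S` is the all-or-nothing configuration `A (τ S)` of the
fair-coin layer `τ S`, whose law is critical site percolation `P_{1/2}` on `𝕋` (`siteEnd_ae_cfg`,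
`siteEnd_law`), so `segCross 0 R δ = P[A (τ S) ∈ …]`. (B) Sandwich (Bollobás–Riordan, *Percolation*
(2006), Ch. 7, Lemma 14 p. 184, Claim 19 p. 192, remark p. 195), with the oracle of Smirnov's theorem in
the tree: LOWER — for the lower comparison rectangle `Q` of `R` (`siteEndCrossings_exists_lowerQuad`,
Cardy value within `ε/2` of `F(η_R)` by `stub_cardyContinuity`) G02's crossing of `Q` on `δ𝕋` is a
crude site crossing of `Q` (`triCrossing_subset_crude`), which forces the crude event of `R`
(`siteEndCrossings_lower`), so `segCross 0 R δ ≥ triDomainCrossingProb Q δ → F(η_Q)`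
(`hasCrossingLimit_triDomainCrossingProb_holds`); UPPER — for the comparison rectangle `N` of the
cyclically re-marked rectangle `R' = (Ω; b, c, d, a)` (`stub_cyclicFlip`: `F(η_{R'}) = 1 - F(η_R)`),
re-marked once more into `D` (`F(η_D) = 1 - F(η_N)`, so `|F(η_D) - F(η_R)| ≤ ε/2`), the crude event
of `R` forces a slack-`1` crude site crossing of `D` (`siteEndCrossings_upper`), whose probability is
eventually `≤ F(η_D) + ε/4` (`crude_upper`, the Bollobás–Riordan shorter–fatter domains, in the tree).
-/

noncomputable section

open MeasureTheory Set Filter Metric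
open scoped Topology ENNReal

namespace Summit.CriticalPhenomena.CardyFormulaZ2.Cruxes.LoopLimitZ2EqT.HexSegment

open Literature.Probability.RandomPlanarGeometry Literature.Probability.Percolation
  Literature.Probability.LatticeModels
open _root_.Summit.CriticalPhenomena.CardyFormulaZ2.Theorems.IKLinearTransport.PinnedDiagramExchange
  (crude_upper triCrossing_subset_crude)
open _root_.Summit.CriticalPhenomena.CardyFormulaZ2.Cruxes.LoopsToCrossings.OracleSandwich
  (stub_cardyContinuity stub_cyclicFlip)

/-! ### Arcs of the cyclically re-marked rectangle -/

/-- The arcs of a re-parametrised, cyclically re-marked copy `(Ω; P₁, P₂, P₃, P₀)` of a conformal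
rectangle (boundary loop `u ↦ R.boundary (u + m₁)`, marks `(0, m₂ - m₁, m₃ - m₁, m₀ + 1 - m₁)`, as
produced by `stub_cyclicFlip`) are those of `R` shifted by one. -/
theorem siteEndCrossings_arc_shift (R R' : ConformalRectangle)
    (hb : ∀ u, R'.boundary u = R.boundary (u + R.mark 1))
    (hm : ∀ i, R'.mark i = ![0, R.mark 2 - R.mark 1, R.mark 3 - R.mark 1, R.mark 0 + 1 - R.mark 1] i) :
    R'.arc 0 = R.arc 1 ∧ R'.arc 1 = R.arc 2 ∧ R'.arc 2 = R.arc 3 ∧ R'.arc 3 = R.arc 0 := by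
  obtain ⟨n0, n1, n2, n3⟩ := R.nextMarks_eq
  obtain ⟨n0', n1', n2', n3'⟩ := R'.nextMarks_eq
  have m0 : R'.mark 0 = 0 := by rw [hm 0]; rfl
  have m1 : R'.mark 1 = R.mark 2 - R.mark 1 := by rw [hm 1]; rfl
  have m2 : R'.mark 2 = R.mark 3 - R.mark 1 := by rw [hm 2]; rfl
  have m3 : R'.mark 3 = R.mark 0 + 1 - R.mark 1 := by rw [hm 3]; rfl
  have hb' : R'.boundary = fun u => R.boundary (u + R.mark 1) := funext hb
  have him : ∀ a b : ℝ, (fun u => R.boundary (u + R.mark 1)) '' Icc a b = R.boundary '' Icc (a + R.mark 1) (b + R.mark 1) :=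
    fun a b => by
    rw [show (fun u => R.boundary (u + R.mark 1)) = R.boundary ∘ fun u => u + R.mark 1 from rfl, image_comp, image_add_const_Icc]
  refine ⟨?_, ?_, ?_, ?_⟩
  · show R'.boundary '' Icc (R'.mark 0) (R'.nextMark 0) = R.boundary '' Icc (R.mark 1) (R.nextMark 1)
    rw [n0', n1, m0, m1, hb', him]; congr 2 <;> ring
  · show R'.boundary '' Icc (R'.mark 1) (R'.nextMark 1) = R.boundary '' Icc (R.mark 2) (R.nextMark 2)
    rw [n1', n2, m1, m2, hb', him]; congr 2 <;> ring
  · show R'.boundary '' Icc (R'.mark 2) (R'.nextMark 2) = R.boundary '' Icc (R.mark 3) (R.nextMark 3)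
    rw [n2', n3, m2, m3, hb', him]; congr 2 <;> ring
  · show R'.boundary '' Icc (R'.mark 3) (R'.nextMark 3) = R.boundary '' Icc (R.mark 0) (R.nextMark 0)
    rw [n3', n0, m3, m0, hb', him]
    have hp : R.boundary = R.boundary ∘ fun u => u + 1 := funext fun u => (R.periodic_boundary u).symm
    conv_rhs => rw [hp, image_comp, image_add_const_Icc]
    congr 2 <;> ring

/-! ### (A) The dictionary: `segCross 0` through the fair-coin layer -/

/-- **(A)** Under `prm 0`, `cfg S` is a.s. the all-or-nothing configuration of the fair-coin layer
(`siteEnd_ae_cfg`), so the probability of any event of `cfg` is that of the corresponding event of the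
all-or-nothing configuration of the layer. -/
theorem siteEndCrossings_real_cfg_eq (E : Set (BondConfig (Site 2))) :
    (prodBernoulli (prm 0)).real {S | cfg S ∈ E} =
      (prodBernoulli (prm 0)).real {S | ({e | ∃ (x : Site 2) (k : Fin 3), e = upEdge x k ∧
        x ∈ ({x : Site 2 | ((x, some (none : Option (Fin 3))) : Coin) ∈ S} : SiteConfig (Site 2))} :
          BondConfig (Site 2)) ∈ E} :=
  measureReal_congr (siteEnd_ae_cfg.mono fun S hS => by
    show (cfg S ∈ E) = (_ ∈ E)
    rw [hS])

/-! ### (B) The sandwich: the registered stub -/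

/-- **S7a, the endpoint dictionary at `t = 0` at crossing level: Cardy's formula for the crude
crossing probabilities of the all-or-nothing model `M₀`.** For every conformal rectangle `R`,
`segCross 0 R δ → F(η_R)` as `δ → 0⁺`. Lower half: Smirnov's theorem for the lower comparison
rectangle `Q` and the deterministic inclusion `siteEndCrossings_lower`; upper half: the crude upper
bound `crude_upper` for the twice re-marked comparison rectangle `D` of `R` and the deterministic
inclusion `siteEndCrossings_upper`; Cardy values compared by `stub_cardyContinuity` and
`stub_cyclicFlip`; the law of the fair-coin layer is `P_{1/2}` (`siteEnd_law`) and `cfg` is a.s. its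
all-or-nothing configuration (`siteEndCrossings_real_cfg_eq`). -/
theorem stub_siteEndCrossings : ∀ R : ConformalRectangle,
    R.HasCrossingLimit (segCross 0 R) Literature.Probability.RandomPlanarGeometry.cardyFunction := by
  intro R φ x hφ
  rw [Metric.tendsto_nhds]
  intro ε hε
  set L := Literature.Probability.RandomPlanarGeometry.cardyFunction (crossRatio x) with hL
  -- the fair-coin layer, its law, and the crude event of `R`
  set τf : Set Coin → SiteConfig (Site 2) :=
    fun S => ({x : Site 2 | ((x, some (none : Option (Fin 3))) : Coin) ∈ S} : SiteConfig (Site 2)) with hτf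
  have hτ : Measurable τf := siteEnd_measurable_fairLayer
  have hlaw : (prodBernoulli (prm 0)).map τf = triSitePercolation half := siteEnd_law
  set Aof : SiteConfig (Site 2) → BondConfig (Site 2) :=
    fun σ => {e | ∃ (x : Site 2) (k : Fin 3), e = upEdge x k ∧ x ∈ σ} with hAof
  have hseg : ∀ δ : ℝ, segCross 0 R δ = (prodBernoulli (prm 0)).real
      {S | Aof (τf S) ∈ embDomainCrossing triEmbed R.carrier δ (R.arc 0) (R.arc 2)} := fun δ =>
    siteEndCrossings_real_cfg_eq _
  -- separation of the arcs `0`, `2` of `R`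
  obtain ⟨dR, hdR, hdR02⟩ := R.exists_pos_forall_lt_dist_arc
  have hA0 : (R.arc 0).Nonempty := ⟨_, R.pt_mem_arc_self 0⟩
  have hA2 : (R.arc 2).Nonempty := ⟨_, R.pt_mem_arc_self 2⟩
  -- LOWER ingredients: the lower comparison rectangle `Q` of `R`
  obtain ⟨ε₁, hε₁, hcont₁⟩ := stub_cardyContinuity R φ x hφ (ε / 2) (half_pos hε)
  obtain ⟨mQ, hmQ, hQfam⟩ := siteEndCrossings_exists_lowerQuad R hε₁
  obtain ⟨Q, rQ, hrQ, hQb, hQm, L1, L2, L3, L4, -, -⟩ := hQfam (dR / 8) (by positivity)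
  obtain ⟨ψQ, yQ, hψQ⟩ := MarkedDomain.exists_isUniformizing_holds Q
  have hFQ := hcont₁ Q hQb hQm ψQ yQ hψQ
  have hSmQ := hasCrossingLimit_triDomainCrossingProb_holds Q ψQ yQ hψQ
  -- UPPER ingredients: the comparison rectangle `N` of the re-marked `R'`, re-marked into `D`
  obtain ⟨R', hR'c, hR'b, hR'm, hflipR⟩ := stub_cyclicFlip R
  obtain ⟨-, a1, -, a3⟩ := siteEndCrossings_arc_shift R R' hR'b hR'm
  obtain ⟨φ', x', hφ'⟩ := MarkedDomain.exists_isUniformizing_holds R'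
  have hF' := hflipR φ x φ' x' hφ hφ'
  obtain ⟨ε₂, hε₂, hcont₂⟩ := stub_cardyContinuity R' φ' x' hφ' (ε / 2) (half_pos hε)
  set ε₀ := min ε₂ (dR / 64) with hε₀
  have hε₀0 : 0 < ε₀ := lt_min hε₂ (by positivity)
  have hε₀2 : ε₀ ≤ ε₂ := min_le_left _ _
  have hε₀d : ε₀ ≤ dR / 64 := min_le_right _ _
  obtain ⟨mN, hmN, hNfam⟩ := siteEndCrossings_exists_lowerQuad R' hε₀0
  obtain ⟨N, rN, hrN, hNb, hNm, -, M2, M3, M4, M5, M6⟩ := hNfam 1 one_pos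
  obtain ⟨ψN, yN, hψN⟩ := MarkedDomain.exists_isUniformizing_holds N
  have hFN := hcont₂ N (fun u => (hNb u).trans hε₀2) (fun i => (hNm i).trans hε₀2) ψN yN hψN
  obtain ⟨D, hDc, hDb, hDm, hflipN⟩ := stub_cyclicFlip N
  obtain ⟨b0, b1, b2, b3⟩ := siteEndCrossings_arc_shift N D hDb hDm
  obtain ⟨ψD, yD, hψD⟩ := MarkedDomain.exists_isUniformizing_holds D
  have hFD := hflipN ψN yN ψD yD hψN hψD
  have hup := crude_upper D (s := 1) zero_le_one ψD yD hψD (ε := ε / 4) (by positivity)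
  -- the clauses of `D` relative to `R`
  have V1 : ∀ z ∈ R.carrier, z ∉ D.carrier → infDist z (D.arc 2) ≤ 2 * ε₀ ∨ infDist z (D.arc 0) ≤ 2 * ε₀ := by
    intro z hz hzD
    rw [b2, b0]; rw [hDc] at hzD; rw [← hR'c] at hz
    exact (M5 z hz hzD).symm
  have V2 : ∀ z ∈ cthickening rN (D.arc 1), z ∉ R.carrier := by
    intro z hz; rw [b1] at hz; rw [← hR'c]; exact (M4 z hz).1
  have V3 : ∀ z ∈ cthickening rN (D.arc 3), z ∉ R.carrier := by
    intro z hz; rw [b3] at hz; rw [← hR'c]; exact (M3 z hz).1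
  have V4 : ∀ z ∈ cthickening rN D.carrier, z ∈ R.carrier → mN ≤ infDist z (R.arc 0) ∧ mN ≤ infDist z (R.arc 2) := by
    intro z hz hzR
    rw [hDc] at hz; rw [← hR'c] at hzR
    obtain ⟨h1, h3⟩ := M2 z hz hzR
    rw [a1] at h1; rw [a3] at h3
    exact ⟨h3, h1⟩
  have hD2 : ∀ a ∈ D.arc 2, ∃ a' ∈ R.arc 0, dist a a' ≤ 2 * (2 * ε₀) := fun a ha => by
    refine exists_dist_le_two_mul_of_mem_cthickening (by positivity) ?_
    rw [← a3]; rw [b2] at ha; exact M6 3 ha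
  have hD0 : ∀ b ∈ D.arc 0, ∃ b' ∈ R.arc 2, dist b b' ≤ 2 * (2 * ε₀) := fun b hb => by
    refine exists_dist_le_two_mul_of_mem_cthickening (by positivity) ?_
    rw [← a1]; rw [b0] at hb; exact M6 1 hb
  have hd : ∀ a ∈ D.arc 2, ∀ b ∈ D.arc 0, dR / 2 < dist a b := fun a ha b hb => by
    obtain ⟨a', ha', haa'⟩ := hD2 a ha
    obtain ⟨b', hb', hbb'⟩ := hD0 b hb
    have := hdR02 a' ha' b' hb'
    rw [dist_comm] at haa'
    linarith [dist_triangle4 a' a b b']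
  have hd0 : ∀ a ∈ R.arc 0, ∀ b ∈ D.arc 0, dR / 2 < dist a b := fun a ha b hb => by
    obtain ⟨b', hb', hbb'⟩ := hD0 b hb
    have := hdR02 a ha b' hb'
    linarith [dist_triangle a b b']
  have hd2 : ∀ a ∈ D.arc 2, ∀ b ∈ R.arc 2, dR / 2 < dist a b := fun a ha b hb => by
    obtain ⟨a', ha', haa'⟩ := hD2 a ha
    have := hdR02 a' ha' b hb
    rw [dist_comm] at haa'
    linarith [dist_triangle a' a b]
  have hdR' : ∀ a ∈ R.arc 0, ∀ b ∈ R.arc 2, dR / 2 < dist a b := fun a ha b hb => by linarith [hdR02 a ha b hb]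
  -- small meshes
  set δ₀ := min (min (min ε₀ (rN / 2)) (min (mN / 4) rQ)) (min mQ (dR / 32)) with hδ₀
  have hδ₀0 : 0 < δ₀ := by positivity
  have hsmall : ∀ᶠ δ in 𝓝[>] (0 : ℝ), δ ∈ Ioo 0 δ₀ := Ioo_mem_nhdsGT hδ₀0
  filter_upwards [hsmall, hup, (Metric.tendsto_nhds.1 hSmQ) (ε / 4) (by positivity)] with δ hδ hupδ hloδ
  have hδ0 : 0 < δ := hδ.1
  have e1 : δ₀ ≤ ε₀ := ((min_le_left _ _).trans (min_le_left _ _)).trans (min_le_left _ _)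
  have e2 : δ₀ ≤ rN / 2 := ((min_le_left _ _).trans (min_le_left _ _)).trans (min_le_right _ _)
  have e3 : δ₀ ≤ mN / 4 := ((min_le_left _ _).trans (min_le_right _ _)).trans (min_le_left _ _)
  have e4 : δ₀ ≤ rQ := ((min_le_left _ _).trans (min_le_right _ _)).trans (min_le_right _ _)
  have e5 : δ₀ ≤ mQ := (min_le_right _ _).trans (min_le_left _ _)
  have e6 : δ₀ ≤ dR / 32 := (min_le_right _ _).trans (min_le_right _ _)
  have hδ1 := hδ.2
  -- LOWER: `triDomainCrossingProb Q δ ≤ segCross 0 R δ`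
  have hsubL : τf ⁻¹' triCrossing Q.carrier δ (Q.arc 0) (Q.arc 2) ⊆
      {S | Aof (τf S) ∈ embDomainCrossing triEmbed R.carrier δ (R.arc 0) (R.arc 2)} := fun S hS => by
    obtain ⟨u, v, hu, hv, hconn⟩ := triCrossing_subset_crude Q le_rfl hδ0 hS
    exact siteEndCrossings_lower R Q L1 L2 L3 L4 hdR02 (by linarith) hδ0 (by linarith) (by linarith) hu hv hconn
  have hLo : triDomainCrossingProb Q δ ≤ segCross 0 R δ := by
    rw [triDomainCrossingProb_eq_measureReal, ← hlaw, hseg, measureReal_def,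
      Measure.map_apply hτ (measurableSet_triCrossing' Q hδ0), ← measureReal_def]
    exact measureReal_mono hsubL
  -- UPPER: `segCross 0 R δ ≤ P_{1/2}[crude₁(D, δ)]`
  have hsubU : {S | Aof (τf S) ∈ embDomainCrossing triEmbed R.carrier δ (R.arc 0) (R.arc 2)} ⊆
      τf ⁻¹' {ω : SiteConfig (Site 2) | ∃ u v : Site 2, infDist (triMeshPoint δ u) (D.arc 0) ≤ 1 * δ ∧
        infDist (triMeshPoint δ v) (D.arc 2) ≤ 1 * δ ∧ ω ∈ siteConnIn triGraph (triMeshVertices D.carrier δ) u v} :=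
    fun S hS => siteEndCrossings_upper R D V1 V2 V3 V4 hd hd0 hd2 hdR' hδ0 (by linarith) (by linarith) (by linarith)
      (by linarith) hS
  have hUp : segCross 0 R δ ≤ (triSitePercolation half).real {ω : SiteConfig (Site 2) | ∃ u v : Site 2,
      infDist (triMeshPoint δ u) (D.arc 0) ≤ 1 * δ ∧ infDist (triMeshPoint δ v) (D.arc 2) ≤ 1 * δ ∧
        ω ∈ siteConnIn triGraph (triMeshVertices D.carrier δ) u v} := by
    rw [hseg, ← hlaw]
    refine (measureReal_mono hsubU).trans ?_
    simp only [measureReal_def]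
    exact ENNReal.toReal_mono (measure_ne_top _ _) (Measure.le_map_apply hτ.aemeasurable _)
  -- the Cardy values
  have hQ : |Literature.Probability.RandomPlanarGeometry.cardyFunction (crossRatio yQ) - L| ≤ ε / 2 := hFQ
  have hD' : |Literature.Probability.RandomPlanarGeometry.cardyFunction (crossRatio yD) - L| ≤ ε / 2 := by
    rw [hFD]
    rw [hF'] at hFN
    have := abs_sub_comm (Literature.Probability.RandomPlanarGeometry.cardyFunction (crossRatio yN)) (1 - L)
    rw [this] at hFN
    convert hFN using 2
    ring
  rw [Real.dist_eq] at hloδ ⊢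
  rw [abs_lt]
  have h1 := (abs_le.1 hQ)
  have h2 := (abs_le.1 hD')
  have h3 := (abs_lt.1 hloδ)
  constructor <;> linarith

end Summit.CriticalPhenomena.CardyFormulaZ2.Cruxes.LoopLimitZ2EqT.HexSegment

end
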